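import Summits.RiemannHypothesis.RiemannHypothesis.Theses.LeeYang
import Literature.Probability.LatticeModels.IsingLimitLawTilt
import HarnessLib

/-!
# Stub `stub_chainMarkov` — the nearest-neighbour Ising chain as a transfer product

Crux `LeeYang.LeeyangThesis` (stmt-RiemannHypothesis-0451), line `Sketch` (card telegraph-string):
the Ising half of the finite dictionary. For step data (piece lengths `ℓ_j ≥ 0`, strictly
increasing impedances `0 < P_0 < P_1 < …`) the nearest-neighbour ferromagnetic chain with `N` spins,
weights `w_j = P_j ℓ_j` and bond couplings `K_j ≥ 0` with `tanh K_j = P_j / P_{j+1}` (concretely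
`K_j = arsinh (P_j / √(P_{j+1}² - P_j²))`, one-sided coupling matrix `J_{j,j+1} = K_j`, all other
entries `0`) has two-sided Laplace transform equal to the `(0,0)` entry of the transfer product
`∏_j !![cosh(h w_j), h P_j sinh(h w_j); sinh(h w_j)/(h P_j), cosh(h w_j)]`.

Proof: transfer-matrix recursion. With `Z_k(h)` the field partition function of the chain `0..k`
and `B_k(h)` the same Gibbs–Laplace sum weighted by the last spin, peeling off the last spin gives
`Z_{k+1} = 2 (cosh(h w_{k+1}) cosh K_k Z_k + sinh(h w_{k+1}) sinh K_k B_k)` and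
`B_{k+1} = 2 (sinh(h w_{k+1}) cosh K_k Z_k + cosh(h w_{k+1}) sinh K_k B_k)`, whence
`(M_0 ⋯ M_k)₀₀ · c_k = Z_k` and `(M_0 ⋯ M_k)₀₁ · c_k = h P_k B_k` for a constant `c_k` independent
of `h`; at `h = 0` the product is `1` (Lean's `x / 0 = 0` makes `M_j(0) = 1`), so `c_k = Z(0)` and
`Z(h)/Z(0) = (∏ M_j)₀₀`, which is the Laplace transform by `integral_exp_isingMagnetizationLaw`.

The file declares no definitions: the chain data are written with file-local notations.
-/

noncomputable section

-- the sub-problem path `RiemannHypothesis/RiemannHypothesis` duplicates a namespace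
set_option linter.dupNamespace false

open MeasureTheory Filter Topology Complex
open scoped ENNReal

namespace Summit.RiemannHypothesis.RiemannHypothesis.Theorems.LeeYangTelegraphString

open Literature.Probability.LatticeModels

/-! ### File-local shorthands (notations, not declarations)

`K P ℓ : ℕ → ℝ` are the couplings, impedances and piece lengths; the chain `0..k` has `k + 1` spins,
weights `w_i = P i * ℓ i` and one-sided nearest-neighbour couplings `J i (i+1) = K i`. -/

/-- `Jc⟪K, n⟫`: the one-sided nearest-neighbour coupling matrix on `Fin n`. -/
local notation:max "Jc⟪" K ", " n "⟫" =>
  (fun i j : Fin n => ite ((i : ℕ) + 1 = (j : ℕ)) (K (i : ℕ)) (0 : ℝ))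

/-- `Fc⟪K, P, ℓ, h, k, s⟫`: the Gibbs–Laplace summand `e^{E(s)} e^{h M(s)}` of the chain `0..k`. -/
local notation:max "Fc⟪" K ", " P ", " ℓ ", " h ", " k ", " s "⟫" =>
  (((isingBoltzmann (Jc⟪K, k + 1⟫) s : ℝ) : ℂ) *
    cexp (h * ((weightedMagnetization (fun i : Fin (k + 1) => P (i : ℕ) * ℓ (i : ℕ)) s : ℝ) : ℂ)))

/-- `Zc⟪K, P, ℓ, h, k⟫ = Z_k(h)`: the field partition function of the chain `0..k`. -/
local notation:max "Zc⟪" K ", " P ", " ℓ ", " h ", " k "⟫" =>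
  isingFieldPartition (Jc⟪K, k + 1⟫) (fun i : Fin (k + 1) => P (i : ℕ) * ℓ (i : ℕ)) h

/-- `Bc⟪K, P, ℓ, h, k⟫ = B_k(h)`: the Gibbs–Laplace sum weighted by the last spin. -/
local notation:max "Bc⟪" K ", " P ", " ℓ ", " h ", " k "⟫" =>
  (∑ s : Fin (k + 1) → Bool, Fc⟪K, P, ℓ, h, k, s⟫ * ((ite (s (Fin.last k) = true) (1 : ℝ) (-1) : ℝ) : ℂ))

/-- `Mt⟪P, ℓ, h, i⟫`: the transfer matrix of piece `i`. -/
local notation:max "Mt⟪" P ", " ℓ ", " h ", " i "⟫" =>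
  !![Complex.cosh (h * ((P i * ℓ i : ℝ) : ℂ)), h * (P i : ℂ) * Complex.sinh (h * ((P i * ℓ i : ℝ) : ℂ));
    Complex.sinh (h * ((P i * ℓ i : ℝ) : ℂ)) / (h * (P i : ℂ)), Complex.cosh (h * ((P i * ℓ i : ℝ) : ℂ))]

/-- `Tp⟪P, ℓ, h, k⟫`: the transfer product `M_0 ⋯ M_k`. -/
local notation:max "Tp⟪" P ", " ℓ ", " h ", " k "⟫" =>
  List.prod (List.ofFn fun j : Fin (k + 1) => Mt⟪P, ℓ, h, (j : ℕ)⟫)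

/-! ### Peeling off the last spin -/

/-- The pair energy of the one-sided nearest-neighbour couplings is the bond sum
`Σ_{i<k} K_i s_i s_{i+1}`. -/
theorem chainMarkov_isingPairEnergy (K : ℕ → ℝ) (k : ℕ) (s : Fin (k + 1) → Bool) :
    isingPairEnergy (Jc⟪K, k + 1⟫) s = ∑ i : Fin k, K i * spinVal s i.castSucc * spinVal s i.succ := by
  simp only [isingPairEnergy]
  rw [Finset.sum_comm, Fin.sum_univ_succ]
  have h0 : ∑ i : Fin (k + 1), (if (i : ℕ) + 1 = ((0 : Fin (k + 1)) : ℕ) then K i else 0) *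
      spinVal s i * spinVal s 0 = 0 := by
    refine Finset.sum_eq_zero fun i _ => ?_
    rw [if_neg (by simp), zero_mul, zero_mul]
  rw [h0, zero_add]
  refine Finset.sum_congr rfl fun j _ => ?_
  rw [Finset.sum_eq_single (Fin.castSucc j)]
  · simp
  · intro i _ hi
    rw [if_neg, zero_mul, zero_mul]
    intro h'
    apply hi
    ext
    simp only [Fin.val_succ, Fin.val_castSucc] at h' ⊢
    omega
  · simp

/-- Adding a spin adds one bond. -/
theorem chainMarkov_isingPairEnergy_snoc (K : ℕ → ℝ) (k : ℕ) (s : Fin (k + 1) → Bool) (b : Bool) :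
    isingPairEnergy (Jc⟪K, k + 1 + 1⟫) (Fin.snoc s b) =
      isingPairEnergy (Jc⟪K, k + 1⟫) s + K k * spinVal s (Fin.last k) * (if b then 1 else -1) := by
  rw [chainMarkov_isingPairEnergy, chainMarkov_isingPairEnergy, Fin.sum_univ_castSucc]
  simp only [spinVal, Fin.val_castSucc, Fin.snoc_castSucc, Fin.succ_castSucc, Fin.val_last,
    Fin.succ_last, Fin.snoc_last]

/-- Adding a spin adds one weight. -/
theorem chainMarkov_weightedMagnetization_snoc (P ℓ : ℕ → ℝ) (k : ℕ) (s : Fin (k + 1) → Bool) (b : Bool) :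
    weightedMagnetization (fun i : Fin (k + 1 + 1) => P (i : ℕ) * ℓ (i : ℕ)) (Fin.snoc s b) =
      weightedMagnetization (fun i : Fin (k + 1) => P (i : ℕ) * ℓ (i : ℕ)) s +
        P (k + 1) * ℓ (k + 1) * (if b then 1 else -1) := by
  unfold weightedMagnetization spinVal
  rw [Fin.sum_univ_castSucc]
  simp only [Fin.val_castSucc, Fin.snoc_castSucc, Fin.val_last, Fin.snoc_last]

/-- Summing over configurations of `k + 1` spins = summing over the last spin and the rest. -/
theorem chainMarkov_sum_config_snoc (k : ℕ) (G : (Fin (k + 1) → Bool) → ℂ) :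
    ∑ s, G s = ∑ b : Bool, ∑ s' : Fin k → Bool, G (Fin.snoc s' b) := by
  rw [← (Fin.snocEquiv fun _ => Bool).sum_comp, Fintype.sum_prod_type]
  rfl

/-- `e^{K σ τ} = cosh K + σ τ sinh K` for spins `σ, τ = ±1`. -/
theorem chainMarkov_exp_coupling (K : ℝ) {n : ℕ} (s : Fin n → Bool) (i : Fin n) (b : Bool) :
    Real.exp (K * spinVal s i * (if b then 1 else -1)) =
      Real.cosh K + spinVal s i * (if b then 1 else -1) * Real.sinh K := by
  unfold spinVal
  rw [Real.cosh_eq, Real.sinh_eq]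
  cases s i <;> cases b <;> simp <;> ring

/-- Peeling the last spin off the Gibbs–Laplace summand. -/
theorem chainMarkov_summand_snoc (K P ℓ : ℕ → ℝ) (h : ℂ) (k : ℕ) (s : Fin (k + 1) → Bool) (b : Bool) :
    Fc⟪K, P, ℓ, h, k + 1, (Fin.snoc s b)⟫ =
      Fc⟪K, P, ℓ, h, k, s⟫ *
        ((Real.cosh (K k) + spinVal s (Fin.last k) * (if b then 1 else -1) * Real.sinh (K k) : ℝ) : ℂ) *
        cexp (h * ((P (k + 1) * ℓ (k + 1) * (if b then 1 else -1) : ℝ) : ℂ)) := by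
  simp only [isingBoltzmann]
  rw [chainMarkov_isingPairEnergy_snoc, chainMarkov_weightedMagnetization_snoc, Real.exp_add, chainMarkov_exp_coupling,
    Complex.ofReal_add, mul_add h, Complex.exp_add, Complex.ofReal_mul]
  ring

/-- **One transfer step**: the sum over the first `k + 1` spins with the new last spin `b` fixed. -/
theorem chainMarkov_sum_summand_snoc (K P ℓ : ℕ → ℝ) (h : ℂ) (k : ℕ) (b : Bool) :
    ∑ s : Fin (k + 1) → Bool, Fc⟪K, P, ℓ, h, k + 1, (Fin.snoc s b)⟫ =
      cexp (h * ((P (k + 1) * ℓ (k + 1) * (if b then 1 else -1) : ℝ) : ℂ)) *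
        ((Real.cosh (K k) : ℂ) * Zc⟪K, P, ℓ, h, k⟫ +
          ((if b then 1 else -1 : ℝ) : ℂ) * (Real.sinh (K k) : ℂ) * Bc⟪K, P, ℓ, h, k⟫) := by
  unfold isingFieldPartition
  rw [Finset.mul_sum, Finset.mul_sum, mul_add, Finset.mul_sum, Finset.mul_sum,
    ← Finset.sum_add_distrib]
  refine Finset.sum_congr rfl fun s _ => ?_
  rw [chainMarkov_summand_snoc]
  simp only [spinVal]
  push_cast
  ring

/-- **Transfer recursion for `Z`.** -/
theorem chainMarkov_partition_succ (K P ℓ : ℕ → ℝ) (h : ℂ) (k : ℕ) :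
    Zc⟪K, P, ℓ, h, k + 1⟫ =
      2 * (Complex.cosh (h * ((P (k + 1) * ℓ (k + 1) : ℝ) : ℂ)) * (Real.cosh (K k) : ℂ) *
        Zc⟪K, P, ℓ, h, k⟫ +
        Complex.sinh (h * ((P (k + 1) * ℓ (k + 1) : ℝ) : ℂ)) * (Real.sinh (K k) : ℂ) *
          Bc⟪K, P, ℓ, h, k⟫) := by
  conv_lhs => unfold isingFieldPartition
  rw [chainMarkov_sum_config_snoc]
  simp only [chainMarkov_sum_summand_snoc, Fintype.sum_bool, Bool.false_eq_true, if_true, if_false, mul_one,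
    Complex.ofReal_neg, Complex.ofReal_one, mul_neg, Complex.cosh, Complex.sinh]
  ring

/-- **Transfer recursion for `B`.** -/
theorem chainMarkov_lastSpin_succ (K P ℓ : ℕ → ℝ) (h : ℂ) (k : ℕ) :
    Bc⟪K, P, ℓ, h, k + 1⟫ =
      2 * (Complex.sinh (h * ((P (k + 1) * ℓ (k + 1) : ℝ) : ℂ)) * (Real.cosh (K k) : ℂ) *
        Zc⟪K, P, ℓ, h, k⟫ +
        Complex.cosh (h * ((P (k + 1) * ℓ (k + 1) : ℝ) : ℂ)) * (Real.sinh (K k) : ℂ) *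
          Bc⟪K, P, ℓ, h, k⟫) := by
  rw [chainMarkov_sum_config_snoc]
  simp only [Fin.snoc_last, ← Finset.sum_mul, chainMarkov_sum_summand_snoc, Fintype.sum_bool, Bool.false_eq_true,
    if_true, if_false, mul_one, Complex.ofReal_neg, Complex.ofReal_one, mul_neg, Complex.cosh,
    Complex.sinh]
  ring

/-- `Z_0 = 2 cosh(h w_0)`. -/
theorem chainMarkov_partition_zero (K P ℓ : ℕ → ℝ) (h : ℂ) :
    Zc⟪K, P, ℓ, h, 0⟫ = 2 * Complex.cosh (h * ((P 0 * ℓ 0 : ℝ) : ℂ)) := by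
  unfold isingFieldPartition
  rw [chainMarkov_sum_config_snoc, Fintype.sum_bool, Fintype.sum_unique, Fintype.sum_unique]
  simp only [isingBoltzmann, chainMarkov_isingPairEnergy, Finset.univ_eq_empty, Finset.sum_empty,
    Real.exp_zero, Complex.ofReal_one, one_mul, weightedMagnetization, spinVal, Fin.sum_univ_castSucc,
    Fin.snoc_last, zero_add, Fin.val_last, Bool.false_eq_true, if_true, if_false, mul_one,
    Complex.ofReal_neg, mul_neg, Complex.cosh]
  ring

/-- `B_0 = 2 sinh(h w_0)`. -/
theorem chainMarkov_lastSpin_zero (K P ℓ : ℕ → ℝ) (h : ℂ) :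
    Bc⟪K, P, ℓ, h, 0⟫ = 2 * Complex.sinh (h * ((P 0 * ℓ 0 : ℝ) : ℂ)) := by
  rw [chainMarkov_sum_config_snoc, Fintype.sum_bool, Fintype.sum_unique, Fintype.sum_unique]
  simp only [isingBoltzmann, chainMarkov_isingPairEnergy, Finset.univ_eq_empty, Finset.sum_empty,
    Real.exp_zero, Complex.ofReal_one, one_mul, weightedMagnetization, spinVal, Fin.sum_univ_castSucc,
    Fin.snoc_last, zero_add, Fin.val_last, Bool.false_eq_true, if_true, if_false, mul_one,
    Complex.ofReal_neg, mul_neg, Complex.sinh]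
  ring

/-! ### Transfer matrices -/

/-- `Tp 0 = M_0`. -/
theorem chainMarkov_transfer_zero (P ℓ : ℕ → ℝ) (h : ℂ) : Tp⟪P, ℓ, h, 0⟫ = Mt⟪P, ℓ, h, 0⟫ := by
  simp [List.ofFn_succ]

/-- `Tp (k+1) = Tp k * M_{k+1}`. -/
theorem chainMarkov_transfer_succ (P ℓ : ℕ → ℝ) (h : ℂ) (k : ℕ) :
    Tp⟪P, ℓ, h, k + 1⟫ = Tp⟪P, ℓ, h, k⟫ * Mt⟪P, ℓ, h, k + 1⟫ := by
  rw [List.ofFn_succ', List.concat_eq_append, List.prod_append, List.prod_singleton]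
  rfl

/-- At `h = 0` every transfer matrix is the identity (Lean's `x / 0 = 0`). -/
theorem chainMarkov_transferMatrix_zero_field (P ℓ : ℕ → ℝ) (i : ℕ) : Mt⟪P, ℓ, (0 : ℂ), i⟫ = 1 := by
  rw [Matrix.one_fin_two]
  simp

/-- At `h = 0` the transfer product is the identity. -/
theorem chainMarkov_transfer_zero_field (P ℓ : ℕ → ℝ) (k : ℕ) : Tp⟪P, ℓ, (0 : ℂ), k⟫ = 1 := by
  refine List.prod_eq_one fun x hx => ?_
  obtain ⟨i, rfl⟩ := List.mem_ofFn.1 hx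
  exact chainMarkov_transferMatrix_zero_field P ℓ i

/-- **Transfer invariant**: `(M_0 ⋯ M_k)₀₀ c_k = Z_k` and `(M_0 ⋯ M_k)₀₁ c_k = h P_k B_k` for a
constant `c_k` independent of the field `h`, as long as `tanh K_i = P_i / P_{i+1}` along the chain. -/
theorem chainMarkov_transfer_invariant (N : ℕ) (P ℓ K : ℕ → ℝ) (hP : ∀ i, i < N → P i ≠ 0)
    (hK : ∀ i, i + 1 < N → Real.sinh (K i) * P (i + 1) = Real.cosh (K i) * P i) :
    ∀ k, k < N → ∃ c : ℂ, ∀ h : ℂ,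
      Tp⟪P, ℓ, h, k⟫ 0 0 * c = Zc⟪K, P, ℓ, h, k⟫ ∧
      Tp⟪P, ℓ, h, k⟫ 0 1 * c = h * (P k : ℂ) * Bc⟪K, P, ℓ, h, k⟫ := by
  intro k
  induction k with
  | zero =>
      intro _
      refine ⟨2, fun h => ?_⟩
      rw [chainMarkov_transfer_zero, chainMarkov_partition_zero, chainMarkov_lastSpin_zero]
      simp only [Matrix.of_apply, Matrix.cons_val', Matrix.cons_val_zero, Matrix.cons_val_one,
        Matrix.cons_val_fin_one]
      constructor <;> ring
  | succ k IH =>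
      intro hk
      obtain ⟨c, hc⟩ := IH (by omega)
      refine ⟨c * (2 * (Real.cosh (K k) : ℂ)), fun h => ?_⟩
      obtain ⟨h1, h2⟩ := hc h
      have htanh : (Real.sinh (K k) : ℂ) * (P (k + 1) : ℂ) = (Real.cosh (K k) : ℂ) * (P k : ℂ) := by
        exact_mod_cast hK k hk
      have hS : Complex.sinh (h * ((P (k + 1) * ℓ (k + 1) : ℝ) : ℂ)) *
          (h * (P (k + 1) : ℂ) * (h * (P (k + 1) : ℂ))⁻¹) =
            Complex.sinh (h * ((P (k + 1) * ℓ (k + 1) : ℝ) : ℂ)) := by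
        rcases eq_or_ne h 0 with rfl | hh
        · simp
        · rw [mul_inv_cancel₀ (mul_ne_zero hh (by exact_mod_cast hP (k + 1) hk)), mul_one]
      rw [chainMarkov_transfer_succ, Matrix.mul_apply, Matrix.mul_apply, Fin.sum_univ_two, Fin.sum_univ_two,
        chainMarkov_partition_succ, chainMarkov_lastSpin_succ]
      simp only [Matrix.of_apply, Matrix.cons_val', Matrix.cons_val_zero, Matrix.cons_val_one,
        Matrix.cons_val_fin_one]
      rw [div_eq_mul_inv]
      constructor
      · linear_combination (2 * (Real.cosh (K k) : ℂ) *
            Complex.cosh (h * ((P (k + 1) * ℓ (k + 1) : ℝ) : ℂ))) * h1 +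
          (2 * (Real.cosh (K k) : ℂ) * Complex.sinh (h * ((P (k + 1) * ℓ (k + 1) : ℝ) : ℂ)) *
            (h * (P (k + 1) : ℂ))⁻¹) * h2 +
          (-(2 * Complex.sinh (h * ((P (k + 1) * ℓ (k + 1) : ℝ) : ℂ)) * Bc⟪K, P, ℓ, h, k⟫ * h *
            (h * (P (k + 1) : ℂ))⁻¹)) * htanh +
          (2 * Bc⟪K, P, ℓ, h, k⟫ * (Real.sinh (K k) : ℂ)) * hS
      · linear_combination (2 * (Real.cosh (K k) : ℂ) * h * (P (k + 1) : ℂ) *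
            Complex.sinh (h * ((P (k + 1) * ℓ (k + 1) : ℝ) : ℂ))) * h1 +
          (2 * (Real.cosh (K k) : ℂ) * Complex.cosh (h * ((P (k + 1) * ℓ (k + 1) : ℝ) : ℂ))) * h2 +
          (-(2 * Complex.cosh (h * ((P (k + 1) * ℓ (k + 1) : ℝ) : ℂ)) * h *
            Bc⟪K, P, ℓ, h, k⟫)) * htanh

/-! ### The couplings -/

/-- `tanh (arsinh (p / √(p'² - p²))) = p / p'` for `0 < p < p'`, in product form. -/
theorem chainMarkov_sinh_arsinh_coupling {p p' : ℝ} (hp : 0 < p) (hpp : p < p') :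
    Real.sinh (Real.arsinh (p / Real.sqrt (p' ^ 2 - p ^ 2))) * p' =
      Real.cosh (Real.arsinh (p / Real.sqrt (p' ^ 2 - p ^ 2))) * p := by
  rw [Real.sinh_arsinh, Real.cosh_arsinh]
  have hd : 0 < p' ^ 2 - p ^ 2 := by nlinarith
  have hs : 0 < Real.sqrt (p' ^ 2 - p ^ 2) := Real.sqrt_pos.2 hd
  have h1 : 1 + (p / Real.sqrt (p' ^ 2 - p ^ 2)) ^ 2 = (p' / Real.sqrt (p' ^ 2 - p ^ 2)) ^ 2 := by
    rw [div_pow, div_pow, Real.sq_sqrt hd.le]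
    field_simp
    ring
  rw [h1, Real.sqrt_sq (div_nonneg (hp.le.trans hpp.le) hs.le)]
  ring

/-! ### The stub -/

/-- **Stub chainMarkov — Ising side of the dictionary.** For step data (`ℓ_j ≥ 0`, `0 < P_0 < P_1 < …`)
the nearest-neighbour chain with weights `w_j = P_j ℓ_j` and bond couplings
`K_j = arsinh (P_j / √(P_{j+1}² - P_j²)) ≥ 0` (so `tanh K_j = P_j / P_{j+1}`; `J_{j,j+1} = K_j`, all
other `J = 0`) is a finite ferromagnet whose Laplace transform is the transfer product
`TP(ℓ, P; h)`. -/
theorem stub_chainMarkov : ∀ (N : ℕ) (ℓ P : Fin N → ℝ), (∀ j, 0 ≤ ℓ j) → (∀ j, 0 < P j) →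
    StrictMono P →
    ∃ (n : ℕ) (J : Fin n → Fin n → ℝ) (w : Fin n → ℝ), (∀ i j, 0 ≤ J i j) ∧ (∀ i, 0 ≤ w i) ∧
      ∀ h : ℂ, ∫ u, cexp (h * u) ∂(isingMagnetizationLaw n J w : Measure ℝ) =
        (List.ofFn fun j : Fin N =>
          !![Complex.cosh (h * ((P j * ℓ j : ℝ) : ℂ)),
              h * (P j : ℂ) * Complex.sinh (h * ((P j * ℓ j : ℝ) : ℂ));
            Complex.sinh (h * ((P j * ℓ j : ℝ) : ℂ)) / (h * (P j : ℂ)),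
              Complex.cosh (h * ((P j * ℓ j : ℝ) : ℂ))]).prod 0 0 := by
  intro N ℓ P hℓ hP hmono
  obtain _ | k := N
  · refine ⟨0, fun _ _ => 0, fun _ => 0, fun _ _ => le_rfl, fun _ => le_rfl, fun h => ?_⟩
    rw [integral_exp_isingMagnetizationLaw]
    simp [isingFieldPartition, isingPairPartition, isingBoltzmann, isingPairEnergy,
      weightedMagnetization]
  · -- extend the step data to `ℕ`-indexed sequences
    obtain ⟨P', hP'⟩ : ∃ P' : ℕ → ℝ, ∀ j : Fin (k + 1), P' j = P j :=
      ⟨fun i => if hi : i < k + 1 then P ⟨i, hi⟩ else 0, fun j => dif_pos j.isLt⟩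
    obtain ⟨ℓ', hℓ'⟩ : ∃ ℓ' : ℕ → ℝ, ∀ j : Fin (k + 1), ℓ' j = ℓ j :=
      ⟨fun i => if hi : i < k + 1 then ℓ ⟨i, hi⟩ else 0, fun j => dif_pos j.isLt⟩
    have hPpos : ∀ i (hi : i < k + 1), 0 < P' i := fun i hi => by
      rw [show (i : ℕ) = ((⟨i, hi⟩ : Fin (k + 1)) : ℕ) from rfl, hP']; exact hP _
    have hPne : ∀ i, i < k + 1 → P' i ≠ 0 := fun i hi => (hPpos i hi).ne'
    have hPlt : ∀ i (hi : i + 1 < k + 1), P' i < P' (i + 1) := fun i hi => by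
      have hi' : i < k + 1 := by omega
      rw [show (i : ℕ) = ((⟨i, hi'⟩ : Fin (k + 1)) : ℕ) from rfl, hP',
        show (i + 1 : ℕ) = ((⟨i + 1, hi⟩ : Fin (k + 1)) : ℕ) from rfl, hP']
      exact hmono (Fin.mk_lt_mk.2 (Nat.lt_succ_self i))
    -- the couplings
    obtain ⟨K, hK0, hK⟩ : ∃ K : ℕ → ℝ, (∀ i, 0 ≤ K i) ∧
        ∀ i, i + 1 < k + 1 → Real.sinh (K i) * P' (i + 1) = Real.cosh (K i) * P' i := by
      refine ⟨fun i => if i + 1 < k + 1 then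
        Real.arsinh (P' i / Real.sqrt (P' (i + 1) ^ 2 - P' i ^ 2)) else 0, fun i => ?_, fun i hi => ?_⟩
      · dsimp only
        split_ifs with hi
        · exact Real.arsinh_nonneg_iff.2
            (div_nonneg (hPpos i (by omega)).le (Real.sqrt_nonneg _))
        · exact le_rfl
      · dsimp only
        rw [if_pos hi]
        exact chainMarkov_sinh_arsinh_coupling (hPpos i (by omega)) (hPlt i hi)
    refine ⟨k + 1, Jc⟪K, k + 1⟫, fun i : Fin (k + 1) => P' (i : ℕ) * ℓ' (i : ℕ), ?_, ?_, ?_⟩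
    · intro i j
      dsimp only
      split_ifs
      · exact hK0 _
      · exact le_rfl
    · intro i
      show 0 ≤ P' i * ℓ' i
      rw [hP', hℓ']
      exact mul_nonneg (hP _).le (hℓ _)
    · intro h
      obtain ⟨c, hc⟩ := chainMarkov_transfer_invariant (k + 1) P' ℓ' K hPne hK k (lt_add_one k)
      have h0 := (hc 0).1
      rw [chainMarkov_transfer_zero_field, Matrix.one_apply_eq, one_mul, isingFieldPartition_zero] at h0
      have hc0 : c ≠ 0 := by
        rw [h0]; exact_mod_cast (isingPairPartition_pos _).ne'
      rw [integral_exp_isingMagnetizationLaw, ← h0, ← (hc h).1, mul_div_assoc, div_self hc0,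
        mul_one]
      simp only [hP', hℓ']

end Summit.RiemannHypothesis.RiemannHypothesis.Theorems.LeeYangTelegraphString
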